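import Mathlib
import Literature.Geometry.Lorentzian.CoordCurvature
import Literature.Geometry.Lorentzian.KerrSchildChartCovariance
import Summits.FinalStateConjecture.FinalStateConjecture.Theorems.EIHFluxBalanceInertialRecessionStubSlavingCoercivity

/-!
# Route EIHFluxBalance — `ModulatedKerrHandoff`, stub `stub_dragDefect`: Minkowski-form algebra of
# the linear drag

Helper file for the crux `stmt-FinalStateConjecture-10167`
(`Summit.FinalStateConjecture.FinalStateConjecture.Theses.EIHFluxBalance.ModulatedKerrHandoff`),
line `overlap-modulation-second-iterate`, stub `stub_dragDefect`.

The drag of the second iterate is the linear vector field `X(y) = Ay` with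
`A = ½ η⁻¹ c` (`η⁻¹ = (Minkowski.bilin).inverse`, `c` a constant symmetric form — the potential of
the far hole at the centre of the near one). This file collects the finite-dimensional algebra:

* `minkowski_isInvertible`, `norm_minkowski_inverse_le`, `abs_minkowski_le`, `norm_minkowski_le` —
  `η♭ : E4 → E4*` is invertible, `‖η⁻¹‖ ≤ 1`, `|η(v,w)| ≤ ‖v‖‖w‖` (Euclidean norm of the chart);
* `minkowski_lieDrag_eq` — **`η(A·,·) + η(·,A·) = c`** for `A = ½ η⁻¹ c`, `c` symmetric: the Lie
  derivative of `η` along `X` is exactly the constant `c`;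
* `bilinearComp_id_add` — `β((1+A)·,(1+A)·) = β + β(A·,·) + β(·,A·) + β(A·,A·)`: the pull-back of
  a form by the AFFINE map `y ↦ y + Ay`, so that `(1+A)^*η = η + c + AᵀηA`
  (`minkowski_pullback_id_add`);
* `isInvertible_of_coercive`, `norm_inverse_le_of_coercive`, `coercive_minkowski_add`,
  `norm_inverse_minkowski_add_le` — forms `η + P` with `‖P‖ ≤ ½` are invertible with
  `‖(η + P)⁻¹‖ ≤ 2` (`η` is `1`-coercive, `norm_le_norm_minkowski_bilin`);
* `isInvertible_id_add` — `1 + A` is invertible for `‖A‖ < 1`.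

O'Neill 1983, Ch. 3, p. 55 and pp. 60–61; elementary.
-/

noncomputable section

-- `Summit.<S>.<S>.…` (single-problem summit, D-0017) trips core's duplicate-namespace linter.
set_option linter.dupNamespace false
set_option maxSynthPendingDepth 3

open Set Function ContinuousLinearMap Literature.Geometry.Lorentzian
open Summit.FinalStateConjecture.FinalStateConjecture.Theorems.SublinearIsFree.Slaving
  (minkowski_timeFlip norm_le_norm_minkowski_bilin coercive_add_of_norm_le)
open scoped RealInnerProductSpace

namespace Summit.FinalStateConjecture.FinalStateConjecture.Theorems

namespace DragDefect

/-! ### `η♭` and its inverse -/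

/-- `η♭ : v ↦ η(v, ·)` is invertible (nondegeneracy in finite dimension).
[cite: ONeill1983, Ch. 3, p. 55] -/
theorem minkowski_isInvertible : (Minkowski.bilin : E4 →L[ℝ] E4 →L[ℝ] ℝ).IsInvertible :=
  MetricCoord.isInvertible_of_nondegenerate Minkowski.bilin_nondegenerate

/-- `η♭ (η⁻¹ α) = α`. [cite: ONeill1983, Ch. 3, p. 60] -/
theorem minkowski_apply_inverse (α : E4 →L[ℝ] ℝ) :
    Minkowski.bilin ((Minkowski.bilin : E4 →L[ℝ] E4 →L[ℝ] ℝ).inverse α) = α :=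
  minkowski_isInvertible.self_apply_inverse α

/-- `η⁻¹ (η♭ v) = v`. [cite: ONeill1983, Ch. 3, p. 60] -/
theorem minkowski_inverse_apply (v : E4) :
    (Minkowski.bilin : E4 →L[ℝ] E4 →L[ℝ] ℝ).inverse (Minkowski.bilin v) = v :=
  minkowski_isInvertible.inverse_apply_self v

/-- **`‖η⁻¹‖ ≤ 1`** (Euclidean operator norms; `η` is `1`-coercive). [folklore] -/
theorem norm_minkowski_inverse_le : ‖(Minkowski.bilin : E4 →L[ℝ] E4 →L[ℝ] ℝ).inverse‖ ≤ 1 := by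
  refine opNorm_le_bound _ zero_le_one fun α ↦ ?_
  rw [one_mul]
  have h := norm_le_norm_minkowski_bilin ((Minkowski.bilin : E4 →L[ℝ] E4 →L[ℝ] ℝ).inverse α)
  rwa [minkowski_apply_inverse] at h

/-- The time flip is an involution. [folklore] -/
theorem timeFlip_timeFlip (w : E4) :
    (w - (2 * w 0) • E4.basisVector 0) - (2 * (w - (2 * w 0) • E4.basisVector 0) 0) •
      E4.basisVector 0 = w := by
  have h0 : (w - (2 * w 0) • E4.basisVector 0) 0 = -w 0 := by
    simp [E4.basisVector]; ring
  rw [h0]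
  ext μ
  simp only [PiLp.sub_apply, PiLp.smul_apply, smul_eq_mul]
  ring

/-- **`|η(v, w)| ≤ ‖v‖ ‖w‖`** (Cauchy–Schwarz after the time flip). [folklore] -/
theorem abs_minkowski_le (v w : E4) : |Minkowski.bilin v w| ≤ ‖v‖ * ‖w‖ := by
  set w' := w - (2 * w 0) • E4.basisVector 0 with hw'
  have h1 : Minkowski.bilin v w = ∑ μ : Fin 4, v μ * w' μ := by
    rw [← minkowski_timeFlip v w', hw', timeFlip_timeFlip]
  have h2 : ∑ μ : Fin 4, v μ * w' μ = ⟪v, w'⟫ := by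
    rw [PiLp.inner_apply]
    refine Finset.sum_congr rfl fun μ _ ↦ ?_
    simp [mul_comm]
  rw [h1, h2]
  have h3 := abs_real_inner_le_norm v w'
  rwa [hw', SublinearIsFree.PseudotensorBound.norm_reflect] at h3

/-- **`‖η♭‖ ≤ 1`**. [folklore] -/
theorem norm_minkowski_le : ‖(Minkowski.bilin : E4 →L[ℝ] E4 →L[ℝ] ℝ)‖ ≤ 1 := by
  refine opNorm_le_bound₂ _ zero_le_one fun v w ↦ ?_
  rw [Real.norm_eq_abs, one_mul]
  exact abs_minkowski_le v w

/-! ### The linear Lie drag of `η` and the affine pull-back -/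

/-- **The Lie derivative of `η` along `X = Ay`, `A = ½ η⁻¹ c`, is `c`**: for a symmetric form `c`,
`η(A v, w) + η(v, A w) = c(v, w)`. [folklore] -/
theorem minkowski_lieDrag_eq (c : E4 →L[ℝ] E4 →L[ℝ] ℝ) (hc : ∀ v w, c v w = c w v) :
    (Minkowski.bilin : E4 →L[ℝ] E4 →L[ℝ] ℝ).comp
        ((2⁻¹ : ℝ) • ((Minkowski.bilin : E4 →L[ℝ] E4 →L[ℝ] ℝ).inverse.comp c))
      + (ContinuousLinearMap.precomp ℝ
          ((2⁻¹ : ℝ) • ((Minkowski.bilin : E4 →L[ℝ] E4 →L[ℝ] ℝ).inverse.comp c))).comp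
        Minkowski.bilin = c := by
  ext v w
  simp only [add_apply, ContinuousLinearMap.comp_apply, smul_apply, map_smul,
    ContinuousLinearMap.precomp_apply, minkowski_apply_inverse, smul_eq_mul]
  rw [Minkowski.bilin_symm v, minkowski_apply_inverse, hc w v]
  ring

/-- **Pull-back of a form by the linear map `1 + A`**:
`β((1+A)v, (1+A)w) = β(v,w) + β(Av,w) + β(v,Aw) + β(Av,Aw)`. [folklore] -/
theorem bilinearComp_id_add {E : Type*} [NormedAddCommGroup E] [NormedSpace ℝ E]
    (β : E →L[ℝ] E →L[ℝ] ℝ) (A : E →L[ℝ] E) :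
    β.bilinearComp (ContinuousLinearMap.id ℝ E + A) (ContinuousLinearMap.id ℝ E + A) =
      β + β.comp A + (ContinuousLinearMap.precomp ℝ A).comp β
        + (ContinuousLinearMap.precomp ℝ A).comp (β.comp A) := by
  ext v w
  simp only [bilinearComp_apply, add_apply, id_apply, map_add, ContinuousLinearMap.comp_apply,
    ContinuousLinearMap.precomp_apply]
  abel

/-- **`(1 + A)^*η = η + c + AᵀηA`** for `A = ½ η⁻¹ c`, `c` symmetric. [folklore] -/
theorem minkowski_pullback_id_add (c : E4 →L[ℝ] E4 →L[ℝ] ℝ) (hc : ∀ v w, c v w = c w v) :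
    (Minkowski.bilin : E4 →L[ℝ] E4 →L[ℝ] ℝ).bilinearComp
        (ContinuousLinearMap.id ℝ E4
          + (2⁻¹ : ℝ) • ((Minkowski.bilin : E4 →L[ℝ] E4 →L[ℝ] ℝ).inverse.comp c))
        (ContinuousLinearMap.id ℝ E4
          + (2⁻¹ : ℝ) • ((Minkowski.bilin : E4 →L[ℝ] E4 →L[ℝ] ℝ).inverse.comp c)) =
      Minkowski.bilin + c + (ContinuousLinearMap.precomp ℝ
          ((2⁻¹ : ℝ) • ((Minkowski.bilin : E4 →L[ℝ] E4 →L[ℝ] ℝ).inverse.comp c))).comp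
        ((Minkowski.bilin : E4 →L[ℝ] E4 →L[ℝ] ℝ).comp
          ((2⁻¹ : ℝ) • ((Minkowski.bilin : E4 →L[ℝ] E4 →L[ℝ] ℝ).inverse.comp c))) := by
  rw [bilinearComp_id_add, add_assoc (Minkowski.bilin : E4 →L[ℝ] E4 →L[ℝ] ℝ),
    minkowski_lieDrag_eq c hc]

/-! ### Coercive forms are invertible with controlled inverse -/

/-- A coercive form `m‖v‖ ≤ ‖B(v,·)‖`, `m > 0`, is invertible (`E4` is finite-dimensional).
[folklore] -/
theorem isInvertible_of_coercive {B : E4 →L[ℝ] E4 →L[ℝ] ℝ} {m : ℝ} (hm : 0 < m)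
    (h : ∀ v : E4, m * ‖v‖ ≤ ‖B v‖) : B.IsInvertible := by
  refine MetricCoord.isInvertible_of_nondegenerate fun v hv ↦ ?_
  have hBv : B v = 0 := ContinuousLinearMap.ext fun w ↦ by rw [hv w]; rfl
  have h1 := h v
  rw [hBv, norm_zero] at h1
  have h2 : ‖v‖ ≤ 0 := by nlinarith [norm_nonneg v]
  exact norm_le_zero_iff.mp h2

/-- The inverse of an `m`-coercive form has norm `≤ m⁻¹`. [folklore] -/
theorem norm_inverse_le_of_coercive {B : E4 →L[ℝ] E4 →L[ℝ] ℝ} {m : ℝ} (hm : 0 < m)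
    (h : ∀ v : E4, m * ‖v‖ ≤ ‖B v‖) : ‖B.inverse‖ ≤ m⁻¹ := by
  have hB := isInvertible_of_coercive hm h
  refine opNorm_le_bound _ (inv_nonneg.mpr hm.le) fun α ↦ ?_
  have h1 := h (B.inverse α)
  rw [hB.self_apply_inverse] at h1
  rw [inv_mul_eq_div, le_div_iff₀ hm, mul_comm]
  exact h1

/-- **`η + P` is `½`-coercive for `‖P‖ ≤ ½`.** [folklore] -/
theorem coercive_minkowski_add {P : E4 →L[ℝ] E4 →L[ℝ] ℝ} (hP : ‖P‖ ≤ 2⁻¹) (v : E4) :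
    2⁻¹ * ‖v‖ ≤ ‖(Minkowski.bilin + P) v‖ := by
  have h := coercive_add_of_norm_le (G := Minkowski.bilin) (m := 1) (e := 2⁻¹)
    (fun v ↦ by rw [one_mul]; exact norm_le_norm_minkowski_bilin v) hP v
  have h' : ‖(Minkowski.bilin + P) v‖ = ‖Minkowski.bilin v + P v‖ := by rw [add_apply]
  rw [h']
  linarith

/-- **`η + P` is invertible for `‖P‖ ≤ ½`.** [folklore] -/
theorem isInvertible_minkowski_add {P : E4 →L[ℝ] E4 →L[ℝ] ℝ} (hP : ‖P‖ ≤ 2⁻¹) :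
    (Minkowski.bilin + P).IsInvertible :=
  isInvertible_of_coercive (by norm_num) (coercive_minkowski_add hP)

/-- **`‖(η + P)⁻¹‖ ≤ 2` for `‖P‖ ≤ ½`.** [folklore] -/
theorem norm_inverse_minkowski_add_le {P : E4 →L[ℝ] E4 →L[ℝ] ℝ} (hP : ‖P‖ ≤ 2⁻¹) :
    ‖(Minkowski.bilin + P).inverse‖ ≤ 2 := by
  have h := norm_inverse_le_of_coercive (by norm_num) (coercive_minkowski_add hP)
  norm_num at h
  exact h

/-- **`1 + A` is invertible for `‖A‖ < 1`** (it is `(1 − ‖A‖)`-coercive, hence injective, on the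
finite-dimensional `E4`). [folklore] -/
theorem isInvertible_id_add {A : E4 →L[ℝ] E4} (hA : ‖A‖ < 1) :
    (ContinuousLinearMap.id ℝ E4 + A).IsInvertible := by
  refine KerrSchildChart.isInvertible_of_injective fun v w hvw ↦ ?_
  rw [← sub_eq_zero]
  have h : (ContinuousLinearMap.id ℝ E4 + A) (v - w) = 0 := by rw [map_sub, hvw, sub_self]
  rw [add_apply, id_apply] at h
  have h' : v - w = -(A (v - w)) := eq_neg_of_add_eq_zero_left h
  have h1 : ‖v - w‖ ≤ ‖A‖ * ‖v - w‖ := by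
    calc ‖v - w‖ = ‖-(A (v - w))‖ := congrArg norm h'
      _ = ‖A (v - w)‖ := norm_neg _
      _ ≤ ‖A‖ * ‖v - w‖ := le_opNorm _ _
  by_contra hne
  have hpos : 0 < ‖v - w‖ := norm_pos_iff.mpr hne
  nlinarith

/-- **Registered sub-goal form** (stub `dragDefect_minkowski_pullback` of the crux item) of
`minkowski_pullback_id_add`. [folklore] -/
theorem dragDefect_minkowski_pullback : open Literature.Geometry.Lorentzian in ∀ (c : E4 →L[ℝ] E4 →L[ℝ] ℝ), (∀ v w, c v w = c w v) → (Minkowski.bilin : E4 →L[ℝ] E4 →L[ℝ] ℝ).bilinearComp (ContinuousLinearMap.id ℝ E4 + (2⁻¹ : ℝ) • ((Minkowski.bilin : E4 →L[ℝ] E4 →L[ℝ] ℝ).inverse.comp c)) (ContinuousLinearMap.id ℝ E4 + (2⁻¹ : ℝ) • ((Minkowski.bilin : E4 →L[ℝ] E4 →L[ℝ] ℝ).inverse.comp c)) = Minkowski.bilin + c + (ContinuousLinearMap.precomp ℝ ((2⁻¹ : ℝ) • ((Minkowski.bilin : E4 →L[ℝ] E4 →L[ℝ] ℝ).inverse.comp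 c))).comp ((Minkowski.bilin : E4 →L[ℝ] E4 →L[ℝ] ℝ).comp ((2⁻¹ : ℝ) • ((Minkowski.bilin : E4 →L[ℝ] E4 →L[ℝ] ℝ).inverse.comp c))) :=
  fun c hc ↦ minkowski_pullback_id_add c hc

end DragDefect

end Summit.FinalStateConjecture.FinalStateConjecture.Theorems

end
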